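import Summits.CriticalPhenomena.SAWScalingLimit.Theorems.SAWDevelopingMapNoFoldBoundWalledClasses
import Summits.CriticalPhenomena.SAWScalingLimit.Theorems.SAWDevelopingMapNoFoldBoundSlitSC
import Literature.Probability.RandomPlanarGeometry.HexMidEdgeSAWDoors

/-!
# Chain-pattern rigidity of first-arrival windings

Helper file for the crux `NoFoldBound` (stmt-CriticalPhenomena-8296) of the route
`SAWDevelopingMap` (sub-problem `SAWScalingLimit` of `CriticalPhenomena`), line `Ideator3Sketch`,
stub `chain_rigidity`.

Setting (Duminil-Copin–Smirnov 2012, §2): `Λ` a finite vertex set of the hexagonal lattice with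
connected complement, a source door `a = {x, u}` (`x ∉ Λ`), a vertex `v ∈ Λ` off `a`, and a
CHAIN `C = (c₁, …, c_m)`: a lattice path avoiding `v` with `c₁ ∼ v` and `c_m ∼ y` for some
`y ∉ Λ`.  For a first arrival `γ` at `v` (a walk `a → {v, p}` avoiding `v`) record, for every
visit of `γ` to a chain vertex `c`, the triple `(pred, c, succ)` of its neighbours on `γ` (`x`
before the first vertex, `v` after the last one): the list
`((x :: γ.verts).zip (γ.verts.zip (γ.verts.tail ++ [v]))).filter (·.2.1 ∈ C)`.  **Two first
arrivals through the same port with the same list of triples have the same winding**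
(`chain_rigidity`).  Proof: the slit domain `D = Λ ∖ (C ∪ {v})` has connected complement
`Λᶜ ∪ C ∪ {v}` (the chain `y, c_m, …, c₁, v` hangs off `Λᶜ`; `slitChain_simplyConnected`).
Induction on the list of triples, for walks `δ : a → {t, q}` with `t ∉ D`, `t, v ∉ δ`
(`winding_eq_of_filter_eq`): with no triple, `δ` is a walk of `D` between two of its boundary
mid-edges, whose winding is rigid (`HexMidEdgeSAW.winding_eq_of_mem_boundary`); otherwise split
`δ.verts = β ++ [c] ++ α` at the LAST chain visit `c` (`exists_lastVisit`; the earlier triples are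
those of `β` with final successor `c`): `W(δ) = W(x, β, c) + turning (pred, c, succ) + W(c, α, t)`
(`winding_eq_three`), the head `β` is a walk `a → {c, pred}` (`exists_headCut`; induction), the
tail `α` a walk of `D` between its doors `{c, succ}`, `{t, q}` (`exists_tailCut`; rigidity).
-/

noncomputable section

open Literature.Probability.LatticeModels Literature.Probability.RandomPlanarGeometry.SAW

namespace Summit.CriticalPhenomena.SAWScalingLimit.Theorems.SAWDevelopingMapNoFoldBound

variable {Λ : Finset HexVertex} {a z : Sym2 HexVertex} {x u v t q c : HexVertex}
  {C β α : List HexVertex}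

/-! ### The triples `(pred, w, succ)` of a vertex list -/

/-- The triples of `w :: L` (predecessor `x`, final successor `t`): `(x, w, head (L ++ [t]))`,
then the triples of `L` with predecessor `w`. -/
theorem triples_cons (x w t : HexVertex) (L : List HexVertex) :
    ((x :: w :: L).zip ((w :: L).zip ((w :: L).tail ++ [t]))) =
      (x, w, L.head?.getD t) :: ((w :: L).zip (L.zip (L.tail ++ [t]))) := by
  cases L <;> rfl

/-- The middle components of the triples of `L` are the entries of `L`. -/
theorem map_triples : ∀ (x : HexVertex) (L : List HexVertex) (t : HexVertex),
    ((x :: L).zip (L.zip (L.tail ++ [t]))).map (fun e => e.2.1) = L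
  | _, [], _ => rfl
  | x, w :: L, t => by rw [triples_cons, List.map_cons, map_triples w L t]

/-- The triples of `β ++ c :: α`: those of `β` (final successor `c`), the triple
`(last (x :: β), c, head (α ++ [t]))` of `c`, and those of `α` (predecessor `c`). -/
theorem triples_append {c t : HexVertex} {α : List HexVertex} :
    ∀ {x pred : HexVertex} {β : List HexVertex}, (x :: β).getLast? = some pred →
    ((x :: (β ++ c :: α)).zip ((β ++ c :: α).zip ((β ++ c :: α).tail ++ [t]))) =
      ((x :: β).zip (β.zip (β.tail ++ [c]))) ++
        (pred, c, α.head?.getD t) :: ((c :: α).zip (α.zip (α.tail ++ [t])))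
  | x, pred, [], h => by
    obtain rfl : x = pred := by simpa using h
    rw [List.nil_append, triples_cons]
    rfl
  | x, pred, w :: β, h => by
    rw [List.getLast?_cons_cons] at h
    rw [List.cons_append, triples_cons, triples_append h, triples_cons, List.cons_append,
      List.head?_append]
    cases β <;> rfl

/-- No entry of `L` lies on the chain iff no triple is recorded. -/
theorem filter_triples_eq_nil_iff {x t : HexVertex} {L : List HexVertex} :
    ((x :: L).zip (L.zip (L.tail ++ [t]))).filter (fun e => e.2.1 ∈ C) = [] ↔ ∀ w ∈ L, w ∉ C := by
  rw [List.filter_eq_nil_iff]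
  constructor
  · intro h w hw
    rw [← map_triples x L t, List.mem_map] at hw
    obtain ⟨e, he, rfl⟩ := hw
    simpa using h e he
  · intro h e he
    have hm : e.2.1 ∈ L := by
      rw [← map_triples x L t]
      exact List.mem_map_of_mem he
    simpa using h _ hm

/-- **Peeling the last chain visit off the list of triples.** If the recorded triples of `L` are
`P₀ ++ [e]`, then `L = β ++ c :: α` with `c ∈ C` the LAST entry on the chain (`α` off the chain),
`e = (last (x :: β), c, head (α ++ [t]))`, and `P₀` the recorded triples of `β` (successor `c`). -/
theorem exists_lastVisit {x t : HexVertex} {L : List HexVertex}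
    {P₀ : List (HexVertex × HexVertex × HexVertex)} {e : HexVertex × HexVertex × HexVertex}
    (hP : ((x :: L).zip (L.zip (L.tail ++ [t]))).filter (fun q => q.2.1 ∈ C) = P₀ ++ [e]) :
    ∃ (β : List HexVertex) (c : HexVertex) (α : List HexVertex) (pred : HexVertex),
      L = β ++ c :: α ∧ c ∈ C ∧ (∀ w ∈ α, w ∉ C) ∧ (x :: β).getLast? = some pred ∧
      ((x :: β).zip (β.zip (β.tail ++ [c]))).filter (fun q => q.2.1 ∈ C) = P₀ ∧
      e = (pred, c, α.head?.getD t) := by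
  have hex : ∃ w ∈ L, decide (w ∉ C) = false := by
    by_contra h
    rw [filter_triples_eq_nil_iff.2 (by simpa using h)] at hP
    simp at hP
  obtain ⟨β₀, α₀, α, c₁, c, rfl, -, hl, -, hc, -, hα⟩ := exists_split_first_last _ hex
  obtain ⟨α₁, rfl⟩ := List.getLast?_eq_some_iff.1 hl
  simp only [decide_eq_false_iff_not, not_not, decide_eq_true_eq] at hc hα
  obtain ⟨pred, hpred⟩ : ∃ pred, (x :: (β₀ ++ α₁)).getLast? = some pred :=
    ⟨_, List.getLast?_eq_some_getLast (List.cons_ne_nil x _)⟩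
  have e₀ : β₀ ++ (α₁ ++ [c]) ++ α = (β₀ ++ α₁) ++ c :: α := by simp
  rw [e₀, triples_append hpred, List.filter_append, List.filter_cons_of_pos (by simpa using hc),
    filter_triples_eq_nil_iff.2 hα] at hP
  obtain ⟨h1, h2⟩ := List.append_inj' hP rfl
  exact ⟨β₀ ++ α₁, c, α, pred, e₀, hc, hα, hpred, h1, (List.singleton_inj.1 h2).symm⟩

/-- The last entry of `x :: β`: `x` if `β = []`, the last entry of `β` otherwise. -/
theorem getLast?_cons_cases {x pred : HexVertex} {β : List HexVertex}
    (h : (x :: β).getLast? = some pred) :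
    (β = [] ∧ x = pred) ∨ (β ≠ [] ∧ β.getLast? = some pred) := by
  cases β with
  | nil => left; simpa using h
  | cons b β => right; exact ⟨List.cons_ne_nil b β, by rwa [List.getLast?_cons_cons] at h⟩

/-! ### The slit domain `Λ ∖ (C ∪ {v})` -/

/-- Membership in the slit domain `Λ ∖ (C ∪ {v})`. -/
theorem mem_slit_iff {w : HexVertex} : w ∈ Λ \ (v :: C).toFinset ↔ w ∈ Λ ∧ w ≠ v ∧ w ∉ C := by
  simp [not_or]

/-- A vertex of a walk of `Λ` avoiding `v`, off the chain, lies in the slit domain. -/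
theorem mem_slit_of_mem (ε : HexMidEdgeSAW Λ a z) (hv : v ∉ ε.verts) {w : HexVertex}
    (hw : w ∈ ε.verts) (hC : w ∉ C) : w ∈ Λ \ (v :: C).toFinset :=
  mem_slit_iff.2 ⟨ε.subset w hw, fun h => hv (h ▸ hw), hC⟩

/-- **The slit domain is simply connected.** If `Λ` has connected complement and `C` is a nonempty
chain whose first vertex is adjacent to `v` and whose last vertex is adjacent to some `y ∉ Λ`,
then `Λ ∖ (C ∪ {v})` has connected complement `Λᶜ ∪ C ∪ {v}`: the chain `y, c_m, …, c₁, v` is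
attached to `Λᶜ` at `y` (`preconnected_induce_union_of_isChain`). -/
theorem slitChain_simplyConnected (hΛ : hexDomainSimplyConnected Λ) (hC : C ≠ [])
    (hchain : C.IsChain hexGraph.Adj) (hhead : ∀ c : HexVertex, C.head? = some c → hexGraph.Adj v c)
    (hlast : ∀ c : HexVertex, C.getLast? = some c → ∃ y : HexVertex, y ∉ Λ ∧ hexGraph.Adj c y) :
    hexDomainSimplyConnected (Λ \ (v :: C).toFinset) := by
  obtain ⟨y, hy, hcy⟩ := hlast (C.getLast hC) (List.getLast?_eq_some_getLast hC)
  unfold hexDomainSimplyConnected at hΛ ⊢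
  have hset : ((↑(Λ \ (v :: C).toFinset) : Set HexVertex)ᶜ) =
      (↑Λ : Set HexVertex)ᶜ ∪ {w | w ∈ C.reverse ++ [v]} := by
    ext f
    simp only [Set.mem_compl_iff, Finset.mem_coe, mem_slit_iff, Set.mem_union, Set.mem_setOf_eq,
      List.mem_append, List.mem_reverse, List.mem_singleton]
    tauto
  rw [hset]
  have hrev : (C.reverse ++ [v]).IsChain hexGraph.Adj := by
    refine List.IsChain.append (List.isChain_reverse.2 (hchain.imp fun a b h => h.symm))
      (List.isChain_singleton v) fun a ha b hb => ?_
    rw [Option.mem_def, List.getLast?_reverse] at ha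
    rw [Option.mem_def, List.head?_cons, Option.some.injEq] at hb
    exact hb ▸ (hhead a ha).symm
  refine preconnected_induce_union_of_isChain (C.reverse ++ [v]) _ y hΛ (by simpa using hy)
    (List.IsChain.cons_of_ne_nil (by simp) hrev ?_)
  rw [List.head_append_of_ne_nil (by simpa using hC), List.head_reverse]
  exact hcy.symm

/-! ### Cutting a walk at a chain visit -/

/-- Transport of a walk to a domain containing its vertices and its source mid-edge. -/
theorem exists_transport {Λ' : Finset HexVertex} (γ : HexMidEdgeSAW Λ a z)
    (h : ∀ w ∈ γ.verts, w ∈ Λ') (ha : a ∈ hexDomainMidEdges Λ') :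
    ∃ γ' : HexMidEdgeSAW Λ' a z, γ'.verts = γ.verts ∧ γ'.winding = γ.winding :=
  ⟨⟨γ.verts, h, γ.nodup, γ.isChain, γ.head_mem, γ.getLast_mem, γ.eq_of_nil, γ.edges_nodup, ha⟩,
    rfl, rfl⟩

/-- If one walk from `a` to `z` is trivial then `a = z` and every walk from `a` to `z` is trivial
(a nontrivial one would use the half-edge `a = z` twice). -/
theorem verts_eq_nil_of_verts_eq_nil (γ γ' : HexMidEdgeSAW Λ a z) (h : γ.verts = []) :
    γ'.verts = [] := by
  by_contra hne
  have hN := γ'.edges_nodup hne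
  rw [List.cons_append, List.nodup_cons] at hN
  exact hN.1 (List.mem_append_right _ (List.mem_singleton.2 (γ.eq_of_nil h)))

/-- A walk to `{t, q}` avoiding `t` ends at `q`. -/
theorem getLast_eq_of_notMem (γ : HexMidEdgeSAW Λ a s(t, q)) (ht : t ∉ γ.verts)
    (hne : γ.verts ≠ []) : γ.verts.getLast hne = q :=
  (γ.getLast_eq_or hne).resolve_left fun h => ht (by have hm := List.getLast_mem hne; rwa [h] at hm)

/-- Restriction of a walk `{x, u} → {t, q}` (`x ∉ Λ`) avoiding `t` to `Λ ∖ {t}`, where both its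
mid-edges are doors. -/
theorem exists_restrict_erase (hx : x ∉ Λ) (hxu : hexGraph.Adj x u)
    (δ : HexMidEdgeSAW Λ s(x, u) s(t, q)) (ht : t ∉ δ.verts) (hne : δ.verts ≠ []) :
    ∃ δ₀ : HexMidEdgeSAW (Λ.erase t) s(x, u) s(t, q), δ₀.verts = δ.verts := by
  have huv : u ∈ δ.verts := by simpa only [δ.head_eq rfl hx hne] using List.head_mem hne
  obtain ⟨δ₀, h₀, -⟩ := exists_transport (Λ' := Λ.erase t) δ
    (fun w hw => Finset.mem_erase.2 ⟨fun h => ht (h ▸ hw), δ.subset w hw⟩)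
    ⟨(SimpleGraph.mem_edgeSet hexGraph).2 hxu, u, Sym2.mem_mk_right _ _,
      Finset.mem_erase.2 ⟨fun h => ht (h ▸ huv), δ.subset u huv⟩⟩
  exact ⟨δ₀, h₀⟩

/-- **Head cut.** The block `β ≠ []` before a vertex `c` of a walk `δ : {x, u} → {t, q}`
(`x ∉ Λ`, `t ∉ δ`) is a walk from `{x, u}` to the mid-edge `{c, pred}` (`pred` the last entry of
`β`) avoiding `c`, with winding that of the lattice polyline `x, β, c`
(`HexMidEdgeSAW.exists_cut` in `Λ ∖ {t}`, `HexMidEdgeSAW.winding_eq_winding_map`). -/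
theorem exists_headCut {pred : HexVertex} (hx : x ∉ Λ) (hxu : hexGraph.Adj x u)
    (δ : HexMidEdgeSAW Λ s(x, u) s(t, q)) (ht : t ∉ δ.verts) (hdec : δ.verts = β ++ c :: α)
    (hpred : β.getLast? = some pred) :
    ∃ δ₁ : HexMidEdgeSAW Λ s(x, u) s(c, pred), δ₁.verts = β ∧ c ∉ δ₁.verts ∧
      δ₁.winding = winding ((x :: (β ++ [c])).map hexCenter) := by
  have hβ : β ≠ [] := by rintro rfl; simp at hpred
  have hne : δ.verts ≠ [] := by rw [hdec]; simp
  have hnd := δ.nodup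
  rw [hdec, List.nodup_append] at hnd
  obtain ⟨δ₀, h₀⟩ := exists_restrict_erase hx hxu δ ht hne
  have hh : β.head? = some u := by
    rw [← List.head?_append_of_ne_nil β hβ (l₂ := c :: α), ← hdec, List.head?_eq_some_head hne,
      δ.head_eq rfl hx hne]
  obtain ⟨δ₁, -, h₁⟩ := δ₀.exists_cut (H := hexGraph) rfl rfl
    (fun h => hx (Finset.mem_of_mem_erase h)) (Finset.notMem_erase t Λ) δ₀.isChain
    (show δ₀.verts = [] ++ β ++ c :: α by rw [h₀, hdec, List.nil_append]) hh hpred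
    (show x :: ([] : List HexVertex) = [] ++ [x] from rfl)
    (show (c :: α) ++ [t] = c :: (α ++ [t]) from rfl) hxu
  obtain ⟨δ₂, h₂, -⟩ := exists_transport (Λ' := Λ) δ₁
    (fun w hw => δ.subset w (by rw [hdec, ← h₁]; exact List.mem_append_left _ hw)) δ.fst_mem
  have h : δ₂.verts = β := h₂.trans h₁
  have hne₂ : δ₂.verts ≠ [] := by rw [h]; exact hβ
  have hc₂ : c ∉ δ₂.verts := by rw [h]; exact fun h' => hnd.2.2 c h' c List.mem_cons_self rfl
  exact ⟨δ₂, h, hc₂, by rw [δ₂.winding_eq_winding_map rfl hx hne₂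
    (Or.inr ⟨getLast_eq_of_notMem δ₂ hc₂ hne₂, rfl⟩), h]⟩

/-- **Tail cut.** The block `α ≠ []` after a vertex `c` of a walk `δ : {x, u} → {t, q}` (`x ∉ Λ`,
`t ∉ δ`) is a walk from the mid-edge `{c, succ}` (`succ` the first entry of `α`) to `{t, q}` in
any domain `Λ' ∌ c` containing `α` (hence `q ∈ Λ'`), with winding that of the lattice polyline
`c, α, t` (`HexMidEdgeSAW.exists_cut` in `Λ ∖ {t}`, `HexMidEdgeSAW.winding_eq_winding_map`). -/
theorem exists_tailCut {Λ' : Finset HexVertex} {succ : HexVertex} (hx : x ∉ Λ)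
    (hxu : hexGraph.Adj x u) (δ : HexMidEdgeSAW Λ s(x, u) s(t, q)) (ht : t ∉ δ.verts)
    (hdec : δ.verts = β ++ c :: α) (hsucc : α.head? = some succ) (hα : ∀ w ∈ α, w ∈ Λ')
    (hc : c ∉ Λ') :
    ∃ δ₂ : HexMidEdgeSAW Λ' s(c, succ) s(t, q), δ₂.verts = α ∧ q ∈ Λ' ∧
      δ₂.winding = winding ((c :: (α ++ [t])).map hexCenter) := by
  have hαne : α ≠ [] := by rintro rfl; simp at hsucc
  have hne : δ.verts ≠ [] := by rw [hdec]; simp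
  obtain ⟨δ₀, h₀⟩ := exists_restrict_erase hx hxu δ ht hne
  have hl : α.getLast? = some q := by
    rw [← List.getLast?_append_of_ne_nil (β ++ [c]) hαne, List.append_assoc, List.singleton_append,
      ← hdec, List.getLast?_eq_some_getLast hne, getLast_eq_of_notMem δ ht hne]
  have hcs : hexGraph.Adj c succ := by
    have h := δ.isChain
    rw [hdec, List.isChain_append] at h
    exact (List.isChain_cons.1 h.2.1).1 succ (by rw [Option.mem_def, hsucc])
  obtain ⟨δ₁, -, h₁⟩ := δ₀.exists_cut (H := hexGraph) rfl rfl
    (fun h => hx (Finset.mem_of_mem_erase h)) (Finset.notMem_erase t Λ) δ₀.isChain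
    (show δ₀.verts = (β ++ [c]) ++ α ++ [] by rw [h₀, hdec]; simp) hsucc hl
    (show x :: (β ++ [c]) = (x :: β) ++ [c] from rfl)
    (show ([] : List HexVertex) ++ [t] = t :: [] from rfl) hcs
  obtain ⟨δ₂, h₂, -⟩ := exists_transport (Λ' := Λ') δ₁ (fun w hw => hα w (h₁ ▸ hw))
    ⟨(SimpleGraph.mem_edgeSet hexGraph).2 hcs, succ, Sym2.mem_mk_right _ _,
      hα succ (List.mem_of_head? hsucc)⟩
  have h : δ₂.verts = α := h₂.trans h₁
  have hne₂ : δ₂.verts ≠ [] := by rw [h]; exact hαne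
  have ht₂ : t ∉ δ₂.verts := fun h' =>
    ht (by rw [hdec]; exact List.mem_append_right β (List.mem_cons_of_mem c (h ▸ h')))
  have hq := getLast_eq_of_notMem δ₂ ht₂ hne₂
  refine ⟨δ₂, h, hα q ?_, by rw [δ₂.winding_eq_winding_map rfl hc hne₂ (Or.inr ⟨hq, rfl⟩), h]⟩
  have hm := List.getLast_mem hne₂
  rwa [hq, h] at hm

/-- Splitting a polyline winding at an interior point `m`. -/
theorem winding_split_at {L₁ L₂ : List ℂ} {p s : ℂ} (m : ℂ) (hp : L₁.getLast? = some p)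
    (hs : L₂.head? = some s) :
    winding (L₁ ++ m :: L₂) = winding (L₁ ++ [m]) + turning p m s + winding (m :: L₂) := by
  obtain ⟨L₁, rfl⟩ := List.getLast?_eq_some_iff.1 hp
  obtain ⟨L₂, rfl⟩ := List.head?_eq_some_iff.1 hs
  rw [winding_append_cons_cons, List.append_assoc, List.append_assoc, List.singleton_append,
    List.singleton_append, winding_concat₃]

/-- **The winding of a walk split at a vertex.** For `δ : {x, u} → {t, q}` (`x ∉ Λ`, `t ∉ δ`) with
`δ.verts = β ++ c :: α`: `W(δ) = W(x, β, c) + turning (pred, c, succ) + W(c, α, t)`, with `W` the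
windings of the lattice polylines `x, β, c` and `c, α, t`, `pred` the last entry of `x :: β` and
`succ` the first entry of `α ++ [t]` (`HexMidEdgeSAW.winding_eq_winding_map`). -/
theorem winding_eq_three {pred : HexVertex} (hx : x ∉ Λ) (δ : HexMidEdgeSAW Λ s(x, u) s(t, q))
    (ht : t ∉ δ.verts) (hdec : δ.verts = β ++ c :: α) (hpred : (x :: β).getLast? = some pred) :
    δ.winding = winding ((x :: (β ++ [c])).map hexCenter) +
      turning (hexCenter pred) (hexCenter c) (hexCenter (α.head?.getD t)) +
      winding ((c :: (α ++ [t])).map hexCenter) := by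
  have hne : δ.verts ≠ [] := by rw [hdec]; simp
  rw [δ.winding_eq_winding_map rfl hx hne (Or.inr ⟨getLast_eq_of_notMem δ ht hne, rfl⟩), hdec]
  have key := winding_split_at (L₁ := (x :: β).map hexCenter) (L₂ := (α ++ [t]).map hexCenter)
    (hexCenter c) (by rw [List.getLast?_map, hpred]; rfl)
    (s := hexCenter (α.head?.getD t)) (by rw [List.head?_map]; cases α <;> rfl)
  simp only [List.map_cons, List.map_append, List.map_nil, List.cons_append,
    List.append_assoc] at key ⊢
  exact key

/-! ### Rigidity -/

/-- **Pattern rigidity (inductive form).** With `D = Λ ∖ (C ∪ {v})` simply connected and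
`x ∉ Λ`, `x ∼ u`: two walks `δ, δ'` from `{x, u}` to a mid-edge `{t, q}` (`t ∉ D`, `t ∼ q`)
avoiding `t` and `v`, with the same recorded triples (final successor `t`), have the same winding.
Induction on the list of triples, peeling the last chain visit (`exists_lastVisit`,
`winding_eq_three`, `exists_headCut`, `exists_tailCut`); with no triple the walks run in `D`
between two of its boundary mid-edges (`HexMidEdgeSAW.winding_eq_of_mem_boundary`). -/
theorem winding_eq_of_filter_eq (hD : hexDomainSimplyConnected (Λ \ (v :: C).toFinset))
    (hx : x ∉ Λ) (hxu : hexGraph.Adj x u) :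
    ∀ (P : List (HexVertex × HexVertex × HexVertex)) {t q : HexVertex}
      (δ δ' : HexMidEdgeSAW Λ s(x, u) s(t, q)), t ∉ Λ \ (v :: C).toFinset → hexGraph.Adj t q →
      t ∉ δ.verts → t ∉ δ'.verts → v ∉ δ.verts → v ∉ δ'.verts →
      ((x :: δ.verts).zip (δ.verts.zip (δ.verts.tail ++ [t]))).filter (fun e => e.2.1 ∈ C) = P →
      ((x :: δ'.verts).zip (δ'.verts.zip (δ'.verts.tail ++ [t]))).filter (fun e => e.2.1 ∈ C) = P →
      δ.winding = δ'.winding := by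
  intro P
  induction P using List.reverseRecOn with
  | nil =>
    intro t q δ δ' htD htq ht ht' hv hv' hP hP'
    by_cases h0 : δ.verts = []
    · rw [HexMidEdgeSAW.ext (h0.trans (verts_eq_nil_of_verts_eq_nil δ δ' h0).symm)]
    have hC := filter_triples_eq_nil_iff.1 hP
    have hC' := filter_triples_eq_nil_iff.1 hP'
    have huv : u ∈ δ.verts := by simpa only [δ.head_eq rfl hx h0] using List.head_mem h0
    have hqv : q ∈ δ.verts := by
      simpa only [getLast_eq_of_notMem δ ht h0] using List.getLast_mem h0
    have huD := mem_slit_of_mem δ hv huv (hC u huv)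
    have ha : s(x, u) ∈ hexDomainMidEdges (Λ \ (v :: C).toFinset) :=
      ⟨(SimpleGraph.mem_edgeSet hexGraph).2 hxu, u, Sym2.mem_mk_right _ _, huD⟩
    obtain ⟨ε, -, hw⟩ := exists_transport δ (fun w h => mem_slit_of_mem δ hv h (hC w h)) ha
    obtain ⟨ε', -, hw'⟩ := exists_transport δ' (fun w h => mem_slit_of_mem δ' hv' h (hC' w h)) ha
    rw [← hw, ← hw']
    exact HexMidEdgeSAW.winding_eq_of_mem_boundary hD ⟨(SimpleGraph.mem_edgeSet hexGraph).2 hxu,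
      x, u, rfl, huD, fun h => hx (Finset.mem_sdiff.1 h).1⟩ ⟨(SimpleGraph.mem_edgeSet hexGraph).2
      htq, t, q, rfl, mem_slit_of_mem δ hv hqv (hC q hqv), htD⟩ ε ε'
  | append_singleton P₀ e ih =>
    intro t q δ δ' htD htq ht ht' hv hv' hP hP'
    obtain ⟨β, c, α, pred, hdec, hc, hα, hpred, hP₀, rfl⟩ := exists_lastVisit hP
    obtain ⟨β', c', α', pred', hdec', -, hα', hpred', hP₀', hee⟩ := exists_lastVisit hP'
    simp only [Prod.mk.injEq] at hee
    obtain ⟨rfl, rfl, hS⟩ := hee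
    have hcD : c ∉ Λ \ (v :: C).toFinset := fun h => (mem_slit_iff.1 h).2.2 hc
    rw [winding_eq_three hx δ ht hdec hpred, winding_eq_three hx δ' ht' hdec' hpred', hS]
    congr 1
    · congr 1
      -- the heads `β`, `β'`: walks `{x, u} → {c, pred}` with recorded triples `P₀`
      rcases getLast?_cons_cases hpred with ⟨rfl, rfl⟩ | ⟨hβ, hl⟩ <;>
        rcases getLast?_cons_cases hpred' with ⟨rfl, hxp⟩ | ⟨hβ', hl'⟩
      · rfl
      · have hm : x ∈ δ'.verts := hdec' ▸ List.mem_append_left _ (List.mem_of_getLast? hl')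
        exact absurd (δ'.subset _ hm) hx
      · subst hxp
        have hm : x ∈ δ.verts := hdec ▸ List.mem_append_left _ (List.mem_of_getLast? hl)
        exact absurd (δ.subset _ hm) hx
      · obtain ⟨δ₁, h₁, hc₁, hw₁⟩ := exists_headCut hx hxu δ ht hdec hl
        obtain ⟨δ₁', h₁', hc₁', hw₁'⟩ := exists_headCut hx hxu δ' ht' hdec' hl'
        have hch := δ.isChain
        rw [hdec, List.isChain_append] at hch
        rw [← hw₁, ← hw₁']
        refine ih δ₁ δ₁' hcD (hch.2.2 pred (by rw [Option.mem_def, hl]) c rfl).symm hc₁ hc₁'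
          (fun h => hv ?_) (fun h => hv' ?_) (by rw [h₁]; exact hP₀) (by rw [h₁']; exact hP₀')
        · rw [hdec]; exact List.mem_append_left _ (h₁ ▸ h)
        · rw [hdec']; exact List.mem_append_left _ (h₁' ▸ h)
    · -- the tails `α`, `α'`: walks of the slit domain `{c, succ} → {t, q}`
      rcases α with _ | ⟨s, α⟩ <;> rcases α' with _ | ⟨s', α'⟩
      · rfl
      · simp only [List.head?_nil, Option.getD_none, List.head?_cons, Option.getD_some] at hS
        exact absurd (by rw [hdec', hS]; simp) ht'
      · simp only [List.head?_nil, Option.getD_none, List.head?_cons, Option.getD_some] at hS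
        exact absurd (by rw [hdec, ← hS]; simp) ht
      · simp only [List.head?_cons, Option.getD_some] at hS
        subst hS
        have hαD : ∀ w ∈ s :: α, w ∈ Λ \ (v :: C).toFinset := fun w hw => mem_slit_of_mem δ hv
          (by rw [hdec]; exact List.mem_append_right β (List.mem_cons_of_mem c hw)) (hα w hw)
        have hαD' : ∀ w ∈ s :: α', w ∈ Λ \ (v :: C).toFinset := fun w hw => mem_slit_of_mem δ' hv'
          (by rw [hdec']; exact List.mem_append_right β' (List.mem_cons_of_mem c hw)) (hα' w hw)
        obtain ⟨δ₂, -, hqD, hw₂⟩ := exists_tailCut hx hxu δ ht hdec rfl hαD hcD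
        obtain ⟨δ₂', -, -, hw₂'⟩ := exists_tailCut hx hxu δ' ht' hdec' rfl hαD' hcD
        rw [← hw₂, ← hw₂']
        exact HexMidEdgeSAW.winding_eq_of_mem_boundary hD
          ⟨δ₂.fst_mem.1, c, s, rfl, hαD s List.mem_cons_self, hcD⟩
          ⟨(SimpleGraph.mem_edgeSet hexGraph).2 htq, t, q, rfl, hqD, htD⟩ δ₂ δ₂'

/-- **Chain-pattern rigidity of first-arrival windings (every depth).** Let `Λ` be simply connected
with source `a = {x, u}` (`x ∉ Λ`, `u ∈ Λ`), `v ∈ Λ` off `a`, and `C` a nonempty lattice path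
inside `Λ` avoiding `v`, from a neighbour of `v` to a vertex adjacent to the complement (a CHAIN
from `v` to `Λᶜ`). For a first arrival `γ` at `v` through the port `p` (`v ∉ γ`) record, for every
visit of `γ` to a chain vertex `c`, the triple `(pred, c, succ)` (predecessor on `γ`, or `x` for
the first vertex; successor on `γ`, or `v` for the last vertex). Two first arrivals through the
same port with the same ordered list of triples have the same winding: between consecutive chain
visits a first arrival is a walk of the simply connected domain `Λ ∖ (C ∪ {v})` between two of its
boundary mid-edges, whose winding is rigid (`HexMidEdgeSAW.winding_eq_of_mem_boundary`), and the
turns at the chain vertices are read off the triples (`winding_eq_of_filter_eq`). -/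
theorem chain_rigidity :
    ∀ (Λ : Finset HexVertex), hexDomainSimplyConnected Λ → ∀ (x u : HexVertex), x ∉ Λ → u ∈ Λ →
      hexGraph.Adj x u → ∀ (v : HexVertex), v ∈ Λ → v ≠ u →
      ∀ (C : List HexVertex), C ≠ [] → (∀ c ∈ C, c ∈ Λ) → v ∉ C → C.IsChain hexGraph.Adj →
      (∀ c : HexVertex, C.head? = some c → hexGraph.Adj v c) →
      (∀ c : HexVertex, C.getLast? = some c → ∃ y : HexVertex, y ∉ Λ ∧ hexGraph.Adj c y) →
      ∀ (p : HexVertex), hexGraph.Adj v p →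
      ∀ (γ γ' : HexMidEdgeSAW Λ s(x, u) s(v, p)), v ∉ γ.verts → v ∉ γ'.verts →
        ((x :: γ.verts).zip (γ.verts.zip (γ.verts.tail ++ [v]))).filter (fun q => q.2.1 ∈ C) =
          ((x :: γ'.verts).zip (γ'.verts.zip (γ'.verts.tail ++ [v]))).filter (fun q => q.2.1 ∈ C) →
        γ.winding = γ'.winding := by
  intro Λ hΛ x u hx _ hxu v _ _ C hC _ _ hchain hhead hlast p hvp γ γ' hvγ hvγ' hpat
  exact winding_eq_of_filter_eq (slitChain_simplyConnected hΛ hC hchain hhead hlast) hx hxu _ γ γ'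
    (fun h => (mem_slit_iff.1 h).2.1 rfl) hvp hvγ hvγ' hvγ hvγ' hpat rfl

end Summit.CriticalPhenomena.SAWScalingLimit.Theorems.SAWDevelopingMapNoFoldBound

end
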